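import Summits.HodgeConjecture.CorCM.MumfordTateRankRibetTypeOnePairsWeilCount
import HarnessLib

/-!
# Two Ribet-type abelian varieties with a COMMON root, ANY dimensions `g, g′ ≥ 3`: `t(A × A′) = g² + g′²` exactly for `A ≁ A′`
# (the Weil classes of the diagonal action on `A^{g′−2} × A′^{g−2}` cut the second central torus)

COR-CM (cell `pub-hodgecm2`, seat `b27` gen 53, count-neutral Mumford–Tate-rank ladder; theorems only, no definition, no named fact; UNCONDITIONAL —
nothing here uses or asserts HC_CM).  `t := dim MT(H¹·)`.  Sequel of `CorCM/MumfordTateRankRibetTypeOnePairs{Exact,Trichotomy}`, which left the cell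
«isomorphic fields, `g ≠ g′`» as `{g² + g′², g² + g′² + 1}`.  HERE `t(A × A′) ≤ g² + g′²`, hence EQUALITY, for Ribet types `(g−1,1)`, `(g′−1,1)` with a
common root `φ ∘ φ = −D = φ′ ∘ φ′`, `A ≁ A′`.  MECHANISM (Moonen–Zarhin Thm. 0.1 (4) one dimension up, as gen 48ʼs `CorCM/MumfordTateRankTypeIVThreefoldPairs`
for `g = g′`): after `φ′ ↦ −φ′` if necessary the multiplicities of `i√D` are `(g−1, 1)` or `(1, g′−1)`; the DIAGONAL action of `k = ℚ(√−D)` on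
`H¹(A^{g′−2} × A′^{g−2})` then has equal multiplicities (WEIL TYPE), its Weil classes are Hodge classes moved by the corner `0 ⊕ Δφ′^*`, and
`Δφ′^* ∈ Lie Hg(⊕ H¹A′) = Δ Lie Hg(H¹A′)`; so `dim Lie Hg(H¹(A^{g′−2} × A′^{g−2})) < g² + g′²` (`corner_not_mem_and_finrank_hodgeLie_lt_of_weilType_of_two_le`
on the bicone of the DIRECT SUMS `⊕ H¹A`, `⊕ H¹A′`, identified with `H¹` of the powers by Künneth `pi_hodge_one_eq_comapEquiv_biproduct`;
`EndAction.multiplicity_pi`; `finrank_hodgeLie_pi_const_eq`), while `t(A × A′) = t(A^{g′−2} × A′^{g−2})` (`CorCM/MumfordTateRankBaseTimesMultiplicities`).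
* §1 = `CorCM/MumfordTateRankRibetTypeOnePairsWeilCount` (`finrank_hodgeLie_hodge_one_biproduct_prod_biproduct_ribetTypeOne_lt`: the Weil-type count
  `2((p+1)n₊ + (q+1)n₊′) = (p+1)g + (q+1)g′` on `(⨁_{p+1} A) × (⨁_{q+1} A′)` gives `dim Lie Hg < g² + g′²`; and `t(A × A′) = t` of that product).
* §2 **`mtRank_hodge_one_le_of_isIsogenous_prod_ribetTypeOne_of_comp_self_eq_neg`** (`t ≤ g² + g′²`); **`…_eq_…_of_comp_self_eq_neg'`** (common root,
  `A ≁ A′`: **`t = g² + g′²`**); **`…_of_nonempty_ringHom'`** (from any ring homomorphism `End⁰A′ → End⁰A`); **`mtRank_hodge_one_trichotomy_…'`** —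
  **`g² + 1` (`A ∼ A′`) / `g² + g′²` (`A ≁ A′`, isomorphic fields) / `g² + g′² + 1` (non-isomorphic fields): the COMPLETE answer** for two Ribet-type varieties.

## References
* [MoonenZarhin1999LowDim] B. Moonen, Yu. G. Zarhin, *Hodge classes on abelian varieties of low dimension*, Math. Ann. 315 (1999), Thm. 0.1 (4), §1,
  §3 (3.1), Lemma (3.4), Prop. (3.8) [corpus: paper:arxiv-math_9901113 pp. 1–2, 5–7]. [cite: MoonenZarhin1999LowDim, Thm. 0.1 (4) and §3 (3.1)]
* [Deligne1982HodgeCycles] P. Deligne, LNM 900 (1982), §4 Prop. 4.4 (Weil classes), I §3 Prop. 3.4. [cite: Deligne1982HodgeCycles, §4 Prop. 4.4]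
* [Ribet1983] K. A. Ribet, Amer. J. Math. 105 (1983), Thm. 3. [cite: Ribet1983, Thm. 3]
* [Moonen1999MTNotes] B. Moonen, *Notes on Mumford–Tate groups* (1999), (1.8) (`MT(V^{⊕n}) ≅ MT(V)` diagonally). [cite: Moonen1999MTNotes, (1.8)]
* [VoisinHodgeI2002] C. Voisin, *Hodge Theory and Complex Algebraic Geometry I*, §7.3.2, Thm. 11.40 (Künneth). [cite: VoisinHodgeI2002, §7.3.2]
-/

noncomputable section

open scoped TensorProduct BigOperators
open CategoryTheory CategoryTheory.Limits Module NumberField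

namespace Summit.HodgeConjecture.CorCM

open Literature.AlgebraicGeometry.Motives
open Literature.AlgebraicGeometry.Motives.AbelianVariety
open Literature.AlgebraicGeometry.Motives.HodgeStructure
open Literature.AlgebraicGeometry.HodgeTheory
open Literature.AlgebraicGeometry.ComplexMultiplication
open Literature.AlgebraicGeometry.Pohlmann1968 (isIsogenous_powSucc_biproduct)

variable [HodgeTensorFacts.{0, 0}] {X : AbelianVariety ℂ} {n : ℕ}

/-! ## §2 `t(A × A′) = g² + g′²` for a common root and `A ≁ A′`, any `g, g′ ≥ 3`; the complete trichotomy -/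

/-- `t(X) ≤ g² + g′²` for `X ∼ A × A′` under the Weil-type count with exponents `p + 1`, `q + 1` (§1 and the transport).
[cite: MoonenZarhin1999LowDim, Thm. 0.1 (4) and §3 (3.1)] [cite: Deligne1982HodgeCycles, §4 Prop. 4.4] -/
theorem mtRank_hodge_one_le_of_isIsogenous_prod_ribetTypeOne_of_bal (hX : IsSmoothProjective n X.X) {A A' : AbelianVariety ℂ} {p q : ℕ}
    (hF : IsField A.endAlgebra) (hnR : ¬ IsTotallyReal (EndField A hF)) (φ : A ⟶ A) {D : ℕ} (hD : 0 < D) (hφ : φ ≫ φ = -(D • 𝟙 A))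
    (hAE : Module.finrank ℚ A.endAlgebra = 2)
    (h1 : eigenMultiplicity A φ (Complex.I * (Real.sqrt D : ℂ)) = 1 ∨ eigenMultiplicity A φ (-(Complex.I * (Real.sqrt D : ℂ))) = 1) (hdim : 3 ≤ A.dim)
    (hF' : IsField A'.endAlgebra) (hnR' : ¬ IsTotallyReal (EndField A' hF')) (φ' : A' ⟶ A') (hφ' : φ' ≫ φ' = -(D • 𝟙 A'))
    (hA'E : Module.finrank ℚ A'.endAlgebra = 2)
    (h1' : eigenMultiplicity A' φ' (Complex.I * (Real.sqrt D : ℂ)) = 1 ∨ eigenMultiplicity A' φ' (-(Complex.I * (Real.sqrt D : ℂ))) = 1)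
    (hdim' : 3 ≤ A'.dim)
    (hbal : 2 * ((p + 1) * eigenMultiplicity A φ (Complex.I * (Real.sqrt D : ℂ)) + (q + 1) * eigenMultiplicity A' φ' (Complex.I * (Real.sqrt D : ℂ))) =
      (p + 1) * A.dim + (q + 1) * A'.dim) (hXP : IsIsogenous X (A.prod A')) :
    haveI := BettiUniverse.finite hX 1
    (BettiUniverse.hodge exists_isReal_hodgeModel_holds hX 1).mtRank ≤ A.dim * A.dim + A'.dim * A'.dim := by
  haveI := BettiUniverse.finite hX 1
  have hY : IsSmoothProjective ((⨁ fun _ : Fin (p + 1) => A).prod (⨁ fun _ : Fin (q + 1) => A')).dim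
      ((⨁ fun _ : Fin (p + 1) => A).prod (⨁ fun _ : Fin (q + 1) => A')).X := AbelianVariety.isSmoothProjective_holds
  haveI := BettiUniverse.finite hY 1
  have hlt := finrank_hodgeLie_hodge_one_biproduct_prod_biproduct_ribetTypeOne_lt hY hF hnR φ hD hφ hAE h1 hdim hF' hnR' φ' hφ' hA'E h1' hdim' hbal
  have h0 : 0 < ((⨁ fun _ : Fin (p + 1) => A).prod (⨁ fun _ : Fin (q + 1) => A')).dim := by
    rw [dim_prod, AndreRiemann.dim_biproduct_fin, Finset.sum_const, Finset.card_univ, Fintype.card_fin, smul_eq_mul]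
    have : 0 < (p + 1) * A.dim := Nat.mul_pos (Nat.succ_pos p) (by omega)
    omega
  rw [mtRank_hodge_one_eq_of_isIsogenous_prod_biproduct_prod_biproduct hX (by omega) (by omega) hXP hY, mtRank_hodge_one_eq_finrank_hodgeLie_add_one hY h0]
  omega

/-- **`t(X) ≤ g² + g′²` for `X ∼ A × A′`, `A`, `A′` of Ribet types `(g−1,1)`, `(g′−1,1)` with a COMMON root `φ ∘ φ = −D = φ′ ∘ φ′`** (any
`g, g′ ≥ 3`; no root matching assumed — one of `± φ′` matches): the Weil classes on `A^{g′−2} × A′^{g−2}`.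
[cite: MoonenZarhin1999LowDim, Thm. 0.1 (4) and §3 (3.1)] [cite: Deligne1982HodgeCycles, §4 Prop. 4.4] [cite: Ribet1983, Thm. 3] -/
theorem mtRank_hodge_one_le_of_isIsogenous_prod_ribetTypeOne_of_comp_self_eq_neg (hX : IsSmoothProjective n X.X) {A A' : AbelianVariety ℂ}
    (hF : IsField A.endAlgebra) (hnR : ¬ IsTotallyReal (EndField A hF)) (φ : A ⟶ A) {D : ℕ} (hD : 0 < D) (hφ : φ ≫ φ = -(D • 𝟙 A))
    (hAE : Module.finrank ℚ A.endAlgebra = 2)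
    (h1 : eigenMultiplicity A φ (Complex.I * (Real.sqrt D : ℂ)) = 1 ∨ eigenMultiplicity A φ (-(Complex.I * (Real.sqrt D : ℂ))) = 1) (hdim : 3 ≤ A.dim)
    (hF' : IsField A'.endAlgebra) (hnR' : ¬ IsTotallyReal (EndField A' hF')) (φ' : A' ⟶ A') (hφ' : φ' ≫ φ' = -(D • 𝟙 A'))
    (hA'E : Module.finrank ℚ A'.endAlgebra = 2)
    (h1' : eigenMultiplicity A' φ' (Complex.I * (Real.sqrt D : ℂ)) = 1 ∨ eigenMultiplicity A' φ' (-(Complex.I * (Real.sqrt D : ℂ))) = 1)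
    (hdim' : 3 ≤ A'.dim) (hXP : IsIsogenous X (A.prod A')) :
    haveI := BettiUniverse.finite hX 1
    (BettiUniverse.hodge exists_isReal_hodgeModel_holds hX 1).mtRank ≤ A.dim * A.dim + A'.dim * A'.dim := by
  obtain ⟨k, hk⟩ : ∃ k, A.dim = k + 3 := ⟨A.dim - 3, by omega⟩
  obtain ⟨k', hk'⟩ : ∃ k', A'.dim = k' + 3 := ⟨A'.dim - 3, by omega⟩
  have hsum := eigenMultiplicity_add_eigenMultiplicity_neg_eq_dim A φ hD hφ
  have hsum' := eigenMultiplicity_add_eigenMultiplicity_neg_eq_dim A' φ' hD hφ'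
  have hφ'n : (-φ') ≫ (-φ') = -(D • 𝟙 A') := by rw [Preadditive.neg_comp, Preadditive.comp_neg, neg_neg, hφ']
  have h1'n : eigenMultiplicity A' (-φ') (Complex.I * (Real.sqrt D : ℂ)) = 1 ∨ eigenMultiplicity A' (-φ') (-(Complex.I * (Real.sqrt D : ℂ))) = 1 := by
    rw [← neg_neg (Complex.I * (Real.sqrt D : ℂ)), eigenMultiplicity_neg_neg, neg_neg, eigenMultiplicity_neg_neg]
    exact h1'.symm
  have hnegval : eigenMultiplicity A' (-φ') (Complex.I * (Real.sqrt D : ℂ)) = eigenMultiplicity A' φ' (-(Complex.I * (Real.sqrt D : ℂ))) := by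
    rw [← neg_neg (Complex.I * (Real.sqrt D : ℂ)), eigenMultiplicity_neg_neg, neg_neg]
  -- choose the sign of `φ'` so that the multiplicities of `i√D` are `(g−1, 1)` or `(1, g′−1)`, then `p + 1 = g′ − 2`, `q + 1 = g − 2`
  rcases h1 with hA1 | hA1
  · rcases h1' with hB1 | hB1
    · -- `(1, 1)`: use `−φ'`, multiplicities `(1, g′−1)`
      refine mtRank_hodge_one_le_of_isIsogenous_prod_ribetTypeOne_of_bal (p := k') (q := k) hX hF hnR φ hD hφ hAE (Or.inl hA1) hdim hF' hnR'
        (-φ') hφ'n hA'E h1'n hdim' ?_ hXP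
      rw [hnegval, hA1, hk, hk']
      have e : eigenMultiplicity A' φ' (-(Complex.I * (Real.sqrt D : ℂ))) = k' + 2 := by omega
      rw [e]; ring
    · -- `(1, g′−1)`: use `φ'`
      refine mtRank_hodge_one_le_of_isIsogenous_prod_ribetTypeOne_of_bal (p := k') (q := k) hX hF hnR φ hD hφ hAE (Or.inl hA1) hdim hF' hnR'
        φ' hφ' hA'E (Or.inr hB1) hdim' ?_ hXP
      rw [hA1, hk, hk']
      have e : eigenMultiplicity A' φ' (Complex.I * (Real.sqrt D : ℂ)) = k' + 2 := by omega
      rw [e]; ring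
  · rcases h1' with hB1 | hB1
    · -- `(g−1, 1)`: use `φ'`
      refine mtRank_hodge_one_le_of_isIsogenous_prod_ribetTypeOne_of_bal (p := k') (q := k) hX hF hnR φ hD hφ hAE (Or.inr hA1) hdim hF' hnR'
        φ' hφ' hA'E (Or.inl hB1) hdim' ?_ hXP
      rw [hB1, hk, hk']
      have e : eigenMultiplicity A φ (Complex.I * (Real.sqrt D : ℂ)) = k + 2 := by omega
      rw [e]; ring
    · -- `(g−1, g′−1)`: use `−φ'`, multiplicities `(g−1, 1)`
      refine mtRank_hodge_one_le_of_isIsogenous_prod_ribetTypeOne_of_bal (p := k') (q := k) hX hF hnR φ hD hφ hAE (Or.inr hA1) hdim hF' hnR'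
        (-φ') hφ'n hA'E h1'n hdim' ?_ hXP
      rw [hnegval, hB1, hk, hk']
      have e : eigenMultiplicity A φ (Complex.I * (Real.sqrt D : ℂ)) = k + 2 := by omega
      rw [e]; ring

/-- **`t(X) = g² + g′²` EXACTLY for `X ∼ A × A′`, `A ≁ A′` of Ribet types `(g−1,1)`, `(g′−1,1)` with a common root `φ ∘ φ = −D = φ′ ∘ φ′`,
ANY `g, g′ ≥ 3`** (isomorphic fields): `Hg(A × A′) ⊇ SU(H¹A) × SU(H¹A′)` with exactly ONE central torus.
[cite: MoonenZarhin1999LowDim, Thm. 0.1 (4), §3 (3.1) and Lemma (3.4)] [cite: Deligne1982HodgeCycles, §4 Prop. 4.4] [cite: Ribet1983, Thm. 3] -/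
theorem mtRank_hodge_one_eq_of_isIsogenous_prod_ribetTypeOne_of_comp_self_eq_neg' (hX : IsSmoothProjective n X.X) {A A' : AbelianVariety ℂ}
    (hF : IsField A.endAlgebra) (hnR : ¬ IsTotallyReal (EndField A hF)) (φ : A ⟶ A) {D : ℕ} (hD : 0 < D) (hφ : φ ≫ φ = -(D • 𝟙 A))
    (hAE : Module.finrank ℚ A.endAlgebra = 2)
    (h1 : eigenMultiplicity A φ (Complex.I * (Real.sqrt D : ℂ)) = 1 ∨ eigenMultiplicity A φ (-(Complex.I * (Real.sqrt D : ℂ))) = 1) (hdim : 3 ≤ A.dim)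
    (hF' : IsField A'.endAlgebra) (hnR' : ¬ IsTotallyReal (EndField A' hF')) (φ' : A' ⟶ A') (hφ' : φ' ≫ φ' = -(D • 𝟙 A'))
    (hA'E : Module.finrank ℚ A'.endAlgebra = 2)
    (h1' : eigenMultiplicity A' φ' (Complex.I * (Real.sqrt D : ℂ)) = 1 ∨ eigenMultiplicity A' φ' (-(Complex.I * (Real.sqrt D : ℂ))) = 1)
    (hdim' : 3 ≤ A'.dim) (hni : ¬ IsIsogenous A A') (hXP : IsIsogenous X (A.prod A')) :
    haveI := BettiUniverse.finite hX 1
    (BettiUniverse.hodge exists_isReal_hodgeModel_holds hX 1).mtRank = A.dim * A.dim + A'.dim * A'.dim :=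
  le_antisymm (mtRank_hodge_one_le_of_isIsogenous_prod_ribetTypeOne_of_comp_self_eq_neg hX hF hnR φ hD hφ hAE h1 hdim hF' hnR' φ' hφ' hA'E h1' hdim' hXP)
    (mtRank_hodge_one_mem_Icc_of_isIsogenous_prod_ribetTypeOne hX hF hnR φ hD hφ hAE h1 hdim hF' hnR' φ' hD hφ' hA'E h1' hdim' hni hXP).1

/-- **`t(X) = g² + g′²` for `X ∼ A × A′`, `A ≁ A′` of Ribet types `(g−1,1)`, `(g′−1,1)` with ISOMORPHIC fields** (any roots `−d`, `−d′`, a ring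
homomorphism `End⁰A′ → End⁰A`; matched roots by `exists_matched_data_of_ringHom_ribetTypeOne`).
[cite: MoonenZarhin1999LowDim, Thm. 0.1 (4), §3 (3.1) and Lemma (3.4)] [cite: Ribet1983, Thm. 3] [cite: MumfordAV1970, §19 Thm. 3 and Cor. 2] -/
theorem mtRank_hodge_one_eq_of_isIsogenous_prod_ribetTypeOne_of_nonempty_ringHom' (hX : IsSmoothProjective n X.X) {A A' : AbelianVariety ℂ}
    (hF : IsField A.endAlgebra) (hnR : ¬ IsTotallyReal (EndField A hF)) (φ : A ⟶ A) {d : ℕ} (hd : 0 < d) (hφ : φ ≫ φ = -(d • 𝟙 A))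
    (hAE : Module.finrank ℚ A.endAlgebra = 2)
    (h1 : eigenMultiplicity A φ (Complex.I * (Real.sqrt d : ℂ)) = 1 ∨ eigenMultiplicity A φ (-(Complex.I * (Real.sqrt d : ℂ))) = 1) (hdim : 3 ≤ A.dim)
    (hF' : IsField A'.endAlgebra) (hnR' : ¬ IsTotallyReal (EndField A' hF')) (φ' : A' ⟶ A') {d' : ℕ} (hd' : 0 < d') (hφ' : φ' ≫ φ' = -(d' • 𝟙 A'))
    (hA'E : Module.finrank ℚ A'.endAlgebra = 2)
    (h1' : eigenMultiplicity A' φ' (Complex.I * (Real.sqrt d' : ℂ)) = 1 ∨ eigenMultiplicity A' φ' (-(Complex.I * (Real.sqrt d' : ℂ))) = 1)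
    (hdim' : 3 ≤ A'.dim) (hfor : Nonempty (A'.endAlgebra →+* A.endAlgebra)) (hni : ¬ IsIsogenous A A') (hXP : IsIsogenous X (A.prod A')) :
    haveI := BettiUniverse.finite hX 1
    (BettiUniverse.hodge exists_isReal_hodgeModel_holds hX 1).mtRank = A.dim * A.dim + A'.dim * A'.dim := by
  obtain ⟨f⟩ := hfor
  obtain ⟨φ₁, φ₁', D, hD, hφ₁, hφ₁', h1₁, h1₁'⟩ := exists_matched_data_of_ringHom_ribetTypeOne f hAE φ hd hφ h1 φ' hd' hφ' h1'
  exact mtRank_hodge_one_eq_of_isIsogenous_prod_ribetTypeOne_of_comp_self_eq_neg' hX hF hnR φ₁ hD hφ₁ hAE h1₁ hdim hF' hnR' φ₁' hφ₁' hA'E h1₁' hdim'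
    hni hXP

/-- **THE COMPLETE ANSWER for two Ribet-type abelian varieties `A`, `A′` of types `(g−1,1)`, `(g′−1,1)`, `g, g′ ≥ 3`:
`t(A × A′) = g² + 1` if `A ∼ A′`; `= g² + g′²` if `A ≁ A′` and `End⁰A ≅ End⁰A′`; `= g² + g′² + 1` if `End⁰A ≇ End⁰A′`** — Moonen–Zarhinʼs threefold
trichotomy `10 / 18 / 19` in all dimensions, including mixed ones. [cite: MoonenZarhin1999LowDim, Thm. 0.1 (4), §3 (3.1), Lemma (3.4) and Prop. (3.8)]
[cite: Ribet1983, Thm. 3] -/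
theorem mtRank_hodge_one_trichotomy_of_isIsogenous_prod_ribetTypeOne' (hX : IsSmoothProjective n X.X) {A A' : AbelianVariety ℂ}
    (hF : IsField A.endAlgebra) (hnR : ¬ IsTotallyReal (EndField A hF)) (φ : A ⟶ A) {d : ℕ} (hd : 0 < d) (hφ : φ ≫ φ = -(d • 𝟙 A))
    (hAE : Module.finrank ℚ A.endAlgebra = 2)
    (h1 : eigenMultiplicity A φ (Complex.I * (Real.sqrt d : ℂ)) = 1 ∨ eigenMultiplicity A φ (-(Complex.I * (Real.sqrt d : ℂ))) = 1) (hdim : 3 ≤ A.dim)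
    (hF' : IsField A'.endAlgebra) (hnR' : ¬ IsTotallyReal (EndField A' hF')) (φ' : A' ⟶ A') {d' : ℕ} (hd' : 0 < d') (hφ' : φ' ≫ φ' = -(d' • 𝟙 A'))
    (hA'E : Module.finrank ℚ A'.endAlgebra = 2)
    (h1' : eigenMultiplicity A' φ' (Complex.I * (Real.sqrt d' : ℂ)) = 1 ∨ eigenMultiplicity A' φ' (-(Complex.I * (Real.sqrt d' : ℂ))) = 1)
    (hdim' : 3 ≤ A'.dim) (hXP : IsIsogenous X (A.prod A')) :
    haveI := BettiUniverse.finite hX 1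
    (IsIsogenous A A' ∧ (BettiUniverse.hodge exists_isReal_hodgeModel_holds hX 1).mtRank = A.dim * A.dim + 1) ∨
      (¬ IsIsogenous A A' ∧ Nonempty (A'.endAlgebra →+* A.endAlgebra) ∧
        (BettiUniverse.hodge exists_isReal_hodgeModel_holds hX 1).mtRank = A.dim * A.dim + A'.dim * A'.dim) ∨
      (IsEmpty (A'.endAlgebra →+* A.endAlgebra) ∧ (BettiUniverse.hodge exists_isReal_hodgeModel_holds hX 1).mtRank = A.dim * A.dim + A'.dim * A'.dim + 1) := by
  haveI := BettiUniverse.finite hX 1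
  by_cases hAA' : IsIsogenous A A'
  · left
    have hT : IsSmoothProjective A.dim A.X := AbelianVariety.isSmoothProjective_holds
    haveI := BettiUniverse.finite hT 1
    refine ⟨hAA', ?_⟩
    rw [mtRank_hodge_one_eq_of_isIsogenous_powSucc hX hT (by omega) (m := 1) (hXP.trans ((IsIsogenous.refl A).prod hAA'.symm')),
      (mtRank_hodge_one_of_ribetTypeOne' hT hF hnR φ hd hφ hAE h1 hdim).1]
  · right
    rcases isEmpty_or_nonempty (A'.endAlgebra →+* A.endAlgebra) with hfor | hfor
    · right
      exact ⟨hfor, mtRank_hodge_one_eq_of_isIsogenous_prod_ribetTypeOne_of_isEmpty_ringHom hX hF hnR φ hd hφ hAE h1 hdim hF' hnR' φ' hd' hφ' hA'E h1'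
        hdim' hfor hXP⟩
    · left
      exact ⟨hAA', hfor, mtRank_hodge_one_eq_of_isIsogenous_prod_ribetTypeOne_of_nonempty_ringHom' hX hF hnR φ hd hφ hAE h1 hdim hF' hnR' φ' hd'
        hφ' hA'E h1' hdim' hfor hAA' hXP⟩

end Summit.HodgeConjecture.CorCM

end
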